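import Literature.NumberTheory.EllipticCurves.MazurTorsionStepTwoAtNProofs
import Literature.NumberTheory.EllipticCurves.SingularCubic
import Mathlib.Algebra.Polynomial.SpecificDegree
import Mathlib.RingTheory.AdjoinRoot
import HarnessLib

/-!
# Mazur 1977, Ch. III §5, Step 2, second sentence: `#Ẽ_ns(𝔽_q) ∣ q² - 1` at a node, and the
# point off the identity component at every bad prime `q < N - 1`

Sibling proof file (theorems only) of `MazurTorsionLocalStepsProofs`, `MazurTorsionStepOneAtNProofs`
and `MazurTorsionStepTwoAtNProofs`, for the prime-case leaf
`Literature.NumberTheory.EllipticCurves.Mazur1977_no_prime_torsion W` (B. Mazur, *Modular curves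
and the Eisenstein ideal*, Publ. Math. IHÉS 47 (1977), Ch. III §5, pp. 156–160).

The second sentence of the proof of Step 2 (p. 159) reads: "But, by Tate's theory
([63], IV, A.1.1), `(E_{/𝔽_q})⁰` is isomorphic to `𝔾_{m/𝔽_q}` which has `q² - 1` points [over
`𝔽_{q²}`]. Again, we cannot have `ℤ/N ⊂ 𝔾_{m/𝔽_q}`, for `q = 2, 3`, by virtue of our hypotheses
on `N`." The tree's `MazurTorsionLocalStepsProofs` used the trivial count `#Ẽ_ns(𝔽_q) ≤ 2q + 1`
instead. Here the multiplicative group is made explicit: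

* `WeierstrassCurve.natCard_point_dvd_sq_sub_one_of_node` — for a Weierstrass cubic over a finite
  field `𝔽_q` of characteristic `≠ 2, 3` with `Δ = 0`, `c₄ ≠ 0` (a node), the group of nonsingular
  points has order dividing `q² - 1`: after Mathlib's `toShortNF` the cubic is
  `y² = (x - r)²(x + 2r)`, `r = -3b/2a ≠ 0`, whose tangent slopes `±√(3r)` lie in `𝔽_q` or in the
  quadratic extension `𝔽_q(√(3r)) = 𝔽_q[T]/(T² - 3r)`, where the tree's `singularModel.nodeEquiv`
  (Silverman, *AEC* III.2.5(a)) identifies the nonsingular points with the multiplicative group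
  (`q - 1`, resp. `q² - 1` elements), and `Ẽ_ns(𝔽_q) ↪ Ẽ_ns(𝔽_{q²})`.
* `prime_dvd_sq_sub_one_of_mem_goodReductionSubgroup` — over `ℚ_q` (`q ≠ 2, 3`) with
  multiplicative reduction: a point of `E₀(ℚ_q)` of prime order `ℓ ≠ q` forces `ℓ ∣ q² - 1`.
* `Mazur1977_not_mem_goodReductionSubgroup_of_lt` — for the putative curve of the leaf (a rational
  point of prime order `N ∉ {2, 3, 5, 7, 13}`) and every prime `q` of bad reduction with
  `q + 1 < N`: the point lies **off** `E₀(ℚ_q)`, the reduction is split multiplicative and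
  `N ∣ c_q = ord_q(Δ_min)` — the conclusion of Mazur's Step 3 ("ℤ/N ⊄ (E_{/𝔽_q})⁰ at every bad
  `q`"), obtained here without modular curves for all bad primes `q < N - 1` (the printed Step 3,
  via `X₀(N)` and the Eisenstein quotient, is needed only for bad primes `q ≥ N - 1`);
  `Mazur1977_reduction_of_lt` is the resulting dichotomy at every prime `q < N - 1`, and
  `Mazur1977_not_mem_goodReductionSubgroup_of_hasse_lt` the unconditional form at the primes
  `q` with `q + 1 + 2√q < N` (all of bad reduction by the Riemann hypothesis).

## References

* [Mazur1977] B. Mazur, *Modular curves and the Eisenstein ideal*, Publ. Math. IHÉS 47 (1977),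
  Ch. III §5, Steps 2–3, pp. 159–160.
* [SilvermanAEC2009] J. H. Silverman, *The Arithmetic of Elliptic Curves*, 2nd ed. (2009),
  III.1.4, III.2.5, VII.2.1, VII.3.1, VII.5.1; Exercise 3.5.
* [SilvermanATAEC1994] J. H. Silverman, *Advanced Topics*, IV.9 Cor. 9.2(d).

## Design

No definitions; `noncomputable section`, `open scoped Classical`. The quadratic extension is
`AdjoinRoot (X² - C(3r))` when `3r` is not a square (irreducible by
`Monic.irreducible_iff_roots_eq_zero_of_degree_le_three`), counted through its power basis.
-/

noncomputable section

open scoped Classical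

open Polynomial

namespace WeierstrassCurve

variable {k : Type*} [Field k] [Fintype k]

/-! ## §1 The node over a finite field: `#Ẽ_ns(𝔽_q) ∣ q² - 1` -/

omit [Fintype k] in
/-- The short nodal cubic: if `4a³ + 27b² = 0`, `a ≠ 0` and `2 ≠ 0`, then with `r = -3b/(2a)` one
has `a = -3r²`, `b = 2r³` (so `x³ + ax + b = (x - r)²(x + 2r)`) and `r ≠ 0`.
[cite: SilvermanAEC2009, Prop. III.1.4(a) (proof)] -/
theorem short_node_factor {a b : k} (h2 : (2 : k) ≠ 0) (hD : 4 * a ^ 3 + 27 * b ^ 2 = 0)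
    (ha : a ≠ 0) :
    a = -3 * (-(3 * b) / (2 * a)) ^ 2 ∧ b = 2 * (-(3 * b) / (2 * a)) ^ 3 ∧
      -(3 * b) / (2 * a) ≠ 0 := by
  have hb : b ≠ 0 := by
    rintro rfl
    apply ha
    have : 4 * a ^ 3 = 0 := by simpa using hD
    rcases mul_eq_zero.mp this with h4 | h
    · exfalso
      exact h2 (by
        have : (2 : k) ^ 2 = 0 := by rw [show (2 : k) ^ 2 = 4 by norm_num]; exact h4
        exact pow_eq_zero_iff two_ne_zero |>.mp this)
    · exact pow_eq_zero_iff three_ne_zero |>.mp h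
  have h2a : 2 * a ≠ 0 := mul_ne_zero h2 ha
  have h3 : (3 : k) ≠ 0 := by
    intro h3
    apply hb
    have : 27 * b ^ 2 = 0 := by
      rw [show (27 : k) = 3 ^ 3 by norm_num, h3]; ring
    have e : 4 * a ^ 3 = 0 := by linear_combination hD - this
    rcases mul_eq_zero.mp e with h4 | h
    · exfalso
      exact h2 (by
        have : (2 : k) ^ 2 = 0 := by rw [show (2 : k) ^ 2 = 4 by norm_num]; exact h4
        exact pow_eq_zero_iff two_ne_zero |>.mp this)
    · exact absurd (pow_eq_zero_iff three_ne_zero |>.mp h) ha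
  refine ⟨?_, ?_, ?_⟩
  · rw [div_pow, eq_comm, mul_div_assoc', div_eq_iff (pow_ne_zero 2 h2a)]
    linear_combination -hD
  · rw [div_pow, eq_comm, mul_div_assoc', div_eq_iff (pow_ne_zero 3 h2a)]
    have ha3 : a ^ 3 ≠ 0 := pow_ne_zero 3 ha
    -- `2 (-3b)³ = b (2a)³` iff `-54 b³ = 8 a³ b` iff `b (8a³ + 54 b²) = 0`
    linear_combination (-(2 : k) * b) * hD
  · rw [Ne, div_eq_zero_iff, not_or]
    exact ⟨by rw [neg_eq_zero]; exact mul_ne_zero h3 hb, h2a⟩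

omit [Fintype k] in
/-- `c₄` and `Δ` of `y² = x³ + ax + b` over a field. [folklore] -/
theorem shortCurve_c₄_Δ_field (a b : k) :
    (Literature.NumberTheory.EllipticCurves.CuspJets.shortCurve a b).c₄ = -48 * a ∧
      (Literature.NumberTheory.EllipticCurves.CuspJets.shortCurve a b).Δ =
        -16 * (4 * a ^ 3 + 27 * b ^ 2) := by
  constructor
  · simp only [WeierstrassCurve.c₄, WeierstrassCurve.b₂, WeierstrassCurve.b₄]
    ring
  · simp only [WeierstrassCurve.Δ, WeierstrassCurve.b₂, WeierstrassCurve.b₄, WeierstrassCurve.b₆,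
      WeierstrassCurve.b₈]
    ring

/-- **The nonsingular points of the nodal cubic `y² = (x - r)²(x + 2r)` over a field `K` containing
a square root `α` of `3r` (`α ≠ -α`)**: they form a group isomorphic to `Kˣ`
(Silverman, *AEC* III.2.5(a); tree `singularModel.nodeEquiv` after `eq_singularModel` at the
singular point `(r, 0)` with tangent slopes `±α`). [cite: SilvermanAEC2009, Prop. III.2.5(a)] -/
theorem nonempty_point_equiv_units_of_sq_eq {K : Type*} [Field K] {r α : K} (hα : α ^ 2 = 3 * r)
    (hα2 : α ≠ -α) :
    Nonempty ((Literature.NumberTheory.EllipticCurves.CuspJets.shortCurve (-3 * r ^ 2) (2 * r ^ 3)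
      ).toAffine.Point ≃+ Additive Kˣ) := by
  set V := Literature.NumberTheory.EllipticCurves.CuspJets.shortCurve (-3 * r ^ 2) (2 * r ^ 3)
  have hE : V.toAffine.Equation r 0 := by
    rw [Affine.equation_iff]
    change (0 : K) ^ 2 + 0 * r * 0 + 0 * 0 = r ^ 3 + 0 * r ^ 2 + (-3 * r ^ 2) * r + 2 * r ^ 3
    ring
  have hX : V.a₁ * 0 = 3 * r ^ 2 + 2 * V.a₂ * r + V.a₄ := by
    change (0 : K) * 0 = 3 * r ^ 2 + 2 * 0 * r + (-3 * r ^ 2)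
    ring
  have hY : 2 * 0 + V.a₁ * r + V.a₃ = 0 := by
    change 2 * 0 + (0 : K) * r + 0 = 0
    ring
  have hs : α + -α = -V.a₁ := by change α + -α = -(0 : K); ring
  have hp : α * -α = -(V.a₂ + 3 * r) := by
    change α * -α = -((0 : K) + 3 * r)
    linear_combination -hα
  have hV := V.eq_singularModel hE hX hY hs hp
  rw [hV]
  exact ⟨singularModel.nodeEquiv hα2⟩

/-- **`#Ẽ_ns(𝔽_q) ∣ q² - 1` at a node** (Mazur 1977, p. 159: "`(E_{/𝔽_q})⁰` is isomorphic to
`𝔾_{m/𝔽_q}` which has `q² - 1` points" over `𝔽_{q²}`; Silverman, *AEC* III.2.5(a) with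
Exercise 3.5): for a Weierstrass cubic `V` over a finite field `k` with `q` elements,
`char k ≠ 2, 3`, `Δ = 0` and `c₄ ≠ 0`, the order of the group of nonsingular points (Mathlib's
`V.toAffine.Point`) divides `q² - 1`. Proof: short form `y² = (x - r)²(x + 2r)`, `r ≠ 0`
(`short_node_factor`); if `3r = α²` in `k` the group is `≅ kˣ`
(`nonempty_point_equiv_units_of_sq_eq`), else it embeds into the group over
`K = k[T]/(T² - 3r)`, which is `≅ Kˣ` of order `q² - 1`.
[cite: Mazur1977, Ch. III §5, Step 2, p. 159; SilvermanAEC2009, Prop. III.2.5(a) and Exercise 3.5] -/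
theorem natCard_point_dvd_sq_sub_one_of_node (V : WeierstrassCurve k) (h2 : ringChar k ≠ 2)
    (h3 : ringChar k ≠ 3) (hΔ : V.Δ = 0) (hc₄ : V.c₄ ≠ 0) :
    Nat.card V.toAffine.Point ∣ Fintype.card k ^ 2 - 1 := by
  have h2' : (2 : k) ≠ 0 := Ring.two_ne_zero h2
  have h3' : (3 : k) ≠ 0 := by
    intro h
    have hdvd : ringChar k ∣ 3 := (ringChar.spec k 3).mp (by exact_mod_cast h)
    rcases (Nat.dvd_prime Nat.prime_three).mp hdvd with h1 | h1
    · exact CharP.ringChar_ne_one h1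
    · exact h3 h1
  haveI : Invertible (2 : k) := invertibleOfNonzero h2'
  haveI : Invertible (3 : k) := invertibleOfNonzero h3'
  -- short form
  set D := V.toShortNF with hD
  haveI hNF : (D • V).IsShortNF := V.toShortNF_spec
  have hDu : D.u = 1 := Literature.NumberTheory.EllipticCurves.toShortNF_u V
  set a := (D • V).a₄ with ha'
  set b := (D • V).a₆ with hb'
  have hM : D • V = Literature.NumberTheory.EllipticCurves.CuspJets.shortCurve a b :=
    WeierstrassCurve.ext hNF.a₁ hNF.a₂ hNF.a₃ rfl rfl
  have hΔ' : 4 * a ^ 3 + 27 * b ^ 2 = 0 := by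
    have e := (shortCurve_c₄_Δ_field a b).2
    rw [← hM, variableChange_Δ, hDu, inv_one, Units.val_one, one_pow, one_mul, hΔ] at e
    have h16 : (-16 : k) ≠ 0 := by
      rw [neg_ne_zero, show (16 : k) = 2 ^ 4 by norm_num]; exact pow_ne_zero 4 h2'
    exact (mul_eq_zero.mp e.symm).resolve_left h16
  have ha : a ≠ 0 := by
    intro h0
    apply hc₄
    have e := (shortCurve_c₄_Δ_field a b).1
    rw [← hM, variableChange_c₄, hDu, inv_one, Units.val_one, one_pow, one_mul] at e
    rw [e, h0, mul_zero]
  obtain ⟨har, hbr, hr⟩ := short_node_factor h2' hΔ' ha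
  set r := -(3 * b) / (2 * a) with hr'
  -- transport the count to the short model `y² = (x - r)²(x + 2r)`
  have hcard : Nat.card V.toAffine.Point = Nat.card (Literature.NumberTheory.EllipticCurves.CuspJets.shortCurve
      (-3 * r ^ 2) (2 * r ^ 3)).toAffine.Point := by
    have e1 : Nat.card V.toAffine.Point = Nat.card (D • V).toAffine.Point :=
      Nat.card_congr (VariableChange.pointEquiv V D).toEquiv
    have hM' : D • V = Literature.NumberTheory.EllipticCurves.CuspJets.shortCurve (-3 * r ^ 2) (2 * r ^ 3) := by
      rw [hM, ← har, ← hbr]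
    rw [e1]
    exact Nat.card_congr (Affine.Point.congrEquiv hM').toEquiv
  rw [hcard]
  have h3r : 3 * r ≠ 0 := mul_ne_zero h3' hr
  by_cases hsq : ∃ α : k, α ^ 2 = 3 * r
  · -- split node: `≅ kˣ`, `q - 1` points
    obtain ⟨α, hα⟩ := hsq
    have hα0 : α ≠ 0 := by rintro rfl; exact h3r (by rw [← hα]; ring)
    have hα2 : α ≠ -α := fun h => hα0 (by
      have : 2 * α = 0 := by linear_combination h
      exact (mul_eq_zero.mp this).resolve_left h2')
    obtain ⟨e⟩ := nonempty_point_equiv_units_of_sq_eq hα hα2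
    rw [Nat.card_congr e.toEquiv, Nat.card_congr Additive.toMul, Nat.card_units,
      Nat.card_eq_fintype_card]
    have h1 : 1 ≤ Fintype.card k := Fintype.card_pos
    exact ⟨Fintype.card k + 1, by zify [h1, Nat.one_le_pow 2 _ h1]; ring⟩
  · -- non-split node: over `K = k[T]/(T² - 3r)`, `≅ Kˣ`, `q² - 1` points
    push Not at hsq
    set f : k[X] := X ^ 2 - C (3 * r) with hf
    have hfm : f.Monic := monic_X_pow_sub_C _ two_ne_zero
    have hfd : f.natDegree = 2 := natDegree_X_pow_sub_C
    have hf0 : f ≠ 0 := hfm.ne_zero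
    have hirr : Irreducible f := by
      rw [hfm.irreducible_iff_roots_eq_zero_of_degree_le_three (by omega) (by omega),
        Multiset.eq_zero_iff_forall_notMem]
      intro α hα
      rw [mem_roots hf0, IsRoot.def, hf, eval_sub, eval_pow, eval_X, eval_C, sub_eq_zero] at hα
      exact hsq α hα
    haveI : Fact (Irreducible f) := ⟨hirr⟩
    set K := AdjoinRoot f
    set α : K := AdjoinRoot.root f with hαd
    have hα : α ^ 2 = 3 * algebraMap k K r := by
      have e := AdjoinRoot.eval₂_root f
      rw [hf, eval₂_sub, eval₂_pow, eval₂_X, eval₂_C, sub_eq_zero] at e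
      rw [e, map_mul, map_ofNat]
      rfl
    have h2K : (2 : K) ≠ 0 := by
      rw [show (2 : K) = algebraMap k K 2 by rw [map_ofNat]]
      exact (_root_.map_ne_zero _).mpr h2'
    have h3rK : 3 * algebraMap k K r ≠ 0 := by
      rw [show (3 : K) * algebraMap k K r = algebraMap k K (3 * r) by rw [map_mul, map_ofNat]]
      exact (_root_.map_ne_zero _).mpr h3r
    have hα0 : α ≠ 0 := by rintro h0; exact h3rK (by rw [← hα, h0]; ring)
    have hα2 : α ≠ -α := fun h => hα0 (by
      have : 2 * α = 0 := by linear_combination h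
      exact (mul_eq_zero.mp this).resolve_left h2K)
    obtain ⟨e⟩ := nonempty_point_equiv_units_of_sq_eq hα hα2
    -- the base change of the short model is the short model over `K`
    set S := Literature.NumberTheory.EllipticCurves.CuspJets.shortCurve (-3 * r ^ 2) (2 * r ^ 3) with hS
    have hSK : S.baseChange K = Literature.NumberTheory.EllipticCurves.CuspJets.shortCurve
        (-3 * algebraMap k K r ^ 2) (2 * algebraMap k K r ^ 3) := by
      simp only [WeierstrassCurve.baseChange, WeierstrassCurve.map, hS, map_zero, map_mul, map_neg,
        map_pow, map_ofNat]
    -- finiteness and cardinality of `K`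
    set pb := AdjoinRoot.powerBasis (K := k) hf0 with hpb
    have hdim : pb.dim = 2 := by rw [hpb, AdjoinRoot.powerBasis_dim, hfd]
    haveI : Finite K := Finite.of_equiv _ pb.basis.equivFun.toEquiv.symm
    have hK : Nat.card K = Fintype.card k ^ 2 := by
      rw [Nat.card_congr pb.basis.equivFun.toEquiv, Nat.card_fun, Nat.card_eq_fintype_card,
        Nat.card_eq_fintype_card, Fintype.card_fin, hdim]
    -- `S(k) ↪ S(K) ≅ Kˣ`
    set ι : S.toAffine.Point →+ (S.baseChange K).toAffine.Point :=
      Affine.Point.map (W' := S.toAffine) (S := k) (Algebra.ofId k K) with hι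
    have hιinj : Function.Injective ι := Affine.Point.map_injective (W' := S.toAffine) (f := Algebra.ofId k K)
    have e' : (S.baseChange K).toAffine.Point ≃+ Additive Kˣ :=
      (Affine.Point.congrEquiv hSK).trans e
    haveI : Finite (S.baseChange K).toAffine.Point := Finite.of_equiv _ e'.toEquiv.symm
    calc Nat.card S.toAffine.Point ∣ Nat.card (S.baseChange K).toAffine.Point :=
          AddSubgroup.card_dvd_of_injective ι hιinj
      _ = Fintype.card k ^ 2 - 1 := by
          rw [Nat.card_congr e'.toEquiv, Nat.card_congr Additive.toMul, Nat.card_units, hK]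

end WeierstrassCurve

namespace Literature.NumberTheory.EllipticCurves

open _root_.WeierstrassCurve

/-! ## §2 Over `ℚ_q`: a point of `E₀` of prime order `ℓ ≠ q` at a multiplicative prime gives `ℓ ∣ q² - 1` -/

/-- The residue field of `ℤ_q` has characteristic `q`. [folklore] -/
private theorem ringChar_residueField_padicInt'' (q : ℕ) [Fact q.Prime] :
    ringChar (IsLocalRing.ResidueField ℤ_[q]) = q := by
  refine CharP.ringChar_of_prime_eq_zero Fact.out ?_
  rw [show (q : IsLocalRing.ResidueField ℤ_[q]) = IsLocalRing.residue ℤ_[q] (q : ℤ_[q]) by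
    rw [map_natCast], IsLocalRing.residue_eq_zero_iff, PadicInt.maximalIdeal_eq_span_p]
  exact Ideal.mem_span_singleton_self _

/-- **Multiplicative reduction at `q ∉ {2, 3}`: a point of `E₀(ℚ_q)` of prime order `ℓ ≠ q`
forces `ℓ ∣ q² - 1`** (Mazur 1977, p. 159, second sentence of Step 2): `⟨P⟩ ↪ Ẽ_ns(𝔽_q)`
(Silverman, *AEC* VII.2.1/VII.3.1; the kernel `E₁` has no `ℓ`-torsion) and
`#Ẽ_ns(𝔽_q) ∣ q² - 1` at a node (`natCard_point_dvd_sq_sub_one_of_node`).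
[cite: Mazur1977, Ch. III §5, Step 2, p. 159; SilvermanAEC2009, VII.2 Prop. 2.1, VII.3 Prop. 3.1(b), VII.5 Prop. 5.1(b)] -/
theorem prime_dvd_sq_sub_one_of_mem_goodReductionSubgroup {q : ℕ} [Fact q.Prime] (hq2 : q ≠ 2)
    (hq3 : q ≠ 3) {ℓ : ℕ} (hℓ : ℓ.Prime) (hqℓ : q ≠ ℓ) (V : WeierstrassCurve ℚ_[q]) [V.IsElliptic]
    [hm : V.HasMultiplicativeReduction ℤ_[q]] {P : V.toAffine.Point} (hP0 : P ≠ 0)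
    (hℓP : (ℓ : ℤ) • P = 0) (hP : P ∈ V.goodReductionSubgroup ℤ_[q]) : ℓ ∣ q ^ 2 - 1 := by
  have hΔ := hm.badReduction
  have hc₄ := hm.multiplicativeReduction
  obtain ⟨W₀, rfl⟩ : ∃ W₀ : WeierstrassCurve ℤ_[q], V = W₀.baseChange ℚ_[q] := IsIntegral.integral
  have eΔ : (W₀.baseChange ℚ_[q]).Δ = algebraMap ℤ_[q] ℚ_[q] W₀.Δ := map_Δ W₀ (algebraMap ℤ_[q] ℚ_[q])
  have ec : (W₀.baseChange ℚ_[q]).c₄ = algebraMap ℤ_[q] ℚ_[q] W₀.c₄ := map_c₄ W₀ (algebraMap ℤ_[q] ℚ_[q])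
  rw [eΔ, IsDedekindDomain.HeightOneSpectrum.valuation_lt_one_iff_mem] at hΔ
  rw [ec, IsDedekindDomain.HeightOneSpectrum.valuation_eq_one_iff_notMem] at hc₄
  have hΔ' : (W₀.map (IsLocalRing.residue ℤ_[q])).Δ = 0 := by
    rw [map_Δ]; exact (IsLocalRing.residue_eq_zero_iff _).mpr hΔ
  have hc₄' : (W₀.map (IsLocalRing.residue ℤ_[q])).c₄ ≠ 0 := by
    rw [map_c₄]; exact fun h => hc₄ ((IsLocalRing.residue_eq_zero_iff _).mp h)
  have hv := integers_valuationRing_valuation ℤ_[q] ℚ_[q]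
  rw [goodReductionSubgroup_baseChange_eq, mem_nonsingularReductionSubgroup_iff] at hP
  haveI : Finite (IsLocalRing.ResidueField ℤ_[q]) :=
    Finite.of_equiv (ZMod q) (PadicInt.residueField (p := q)).symm.toEquiv
  haveI := Fintype.ofFinite (IsLocalRing.ResidueField ℤ_[q])
  haveI : Finite (W₀.map (IsLocalRing.residue ℤ_[q])).toAffine.Point := finite_point _
  -- `⟨P⟩ ↪ Ẽ_ns(𝔽_q)`
  have hℓv : ValuationRing.valuation ℤ_[q] ℚ_[q] ((ℓ : ℤ) : ℚ_[q]) = 1 := by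
    rw [show ((ℓ : ℤ) : ℚ_[q]) = algebraMap ℤ_[q] ℚ_[q] (ℓ : ℤ_[q]) by simp,
      v_algebraMap_eq_one_iff hv]
    simpa using natCast_residueField_padicInt_ne_zero q hℓ hqℓ
  have hle : AddSubgroup.zmultiples P ≤ W₀.nonsingularReductionSubgroup hv :=
    AddSubgroup.zmultiples_le_of_mem hP
  set f : AddSubgroup.zmultiples P →+ (W₀.map (IsLocalRing.residue ℤ_[q])).toAffine.Point :=
    (W₀.reductionHom hv).comp (AddSubgroup.inclusion hle) with hf_def
  have hf : Function.Injective f := by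
    rw [injective_iff_map_eq_zero]
    rintro ⟨Q, hQ⟩ hfQ
    obtain ⟨m, rfl⟩ := AddSubgroup.mem_zmultiples_iff.mp hQ
    have hred : W₀.reducePoint (m • P) = 0 := hfQ
    have h0 : W₀.ReducesToZero (m • P) :=
      (_root_.WeierstrassCurve.reducePoint_eq_zero_iff hv (hle hQ)).mp hred
    have hp' : (ℓ : ℤ) • (m • P) = 0 := by
      rw [← mul_zsmul, mul_comm, mul_zsmul, hℓP, zsmul_zero]
    by_contra hne
    exact not_reducesToZero_of_zsmul_eq_zero hv hℓv hp' (fun h => hne (Subtype.ext h)) h0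
  haveI : Fact ℓ.Prime := ⟨hℓ⟩
  have hord : addOrderOf P = ℓ := by
    refine addOrderOf_eq_prime ?_ hP0
    rw [← natCast_zsmul]; exact hℓP
  have h1 : ℓ ∣ Nat.card (W₀.map (IsLocalRing.residue ℤ_[q])).toAffine.Point := by
    calc ℓ = Nat.card (AddSubgroup.zmultiples P) := by rw [Nat.card_zmultiples, hord]
      _ ∣ _ := AddSubgroup.card_dvd_of_injective f hf
  -- `#Ẽ_ns(𝔽_q) ∣ q² - 1`
  have h2 : ringChar (IsLocalRing.ResidueField ℤ_[q]) ≠ 2 := by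
    rw [ringChar_residueField_padicInt'']; exact hq2
  have h3 : ringChar (IsLocalRing.ResidueField ℤ_[q]) ≠ 3 := by
    rw [ringChar_residueField_padicInt'']; exact hq3
  have hnode := (W₀.map (IsLocalRing.residue ℤ_[q])).natCard_point_dvd_sq_sub_one_of_node h2 h3 hΔ' hc₄'
  rw [← Nat.card_eq_fintype_card, natCard_residueField_padicInt] at hnode
  exact h1.trans hnode

/-! ## §3 Over `ℚ`: the point is off `E₀` at every bad prime `q < N - 1` -/

section Rat

variable (W : WeierstrassCurve ℚ) [W.IsElliptic] (q : ℕ) [Fact q.Prime]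

/-- **Mazur's Step 3 conclusion at every bad prime `q < N - 1`, without modular curves.** Let
`E/ℚ` have a rational point `P` of prime order `N ∉ {2, 3, 5, 7, 13}` and let `q` be a prime of
bad reduction with `q + 1 < N`. Then `P` lies off `E₀(ℚ_q)` (on the minimal model), `E` has split
multiplicative reduction at `q`, and `N ∣ c_q(E) = ord_q(Δ_min)`. For `q = 2, 3` this is the
tree's `Mazur1977_stepTwo_padic`; for `q ≥ 5`: the reduction is multiplicative (Step 1,
`Mazur1977_stepOne_padic`), and `P ∈ E₀(ℚ_q)` would give `N ∣ q² - 1`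
(`prime_dvd_sq_sub_one_of_mem_goodReductionSubgroup`), i.e. `N ≤ q + 1`; off `E₀` the
Kodaira–Néron index argument (`hasSplitMultiplicativeReduction_of_not_mem_goodReductionSubgroup`)
gives the rest. (The printed Step 3, p. 159, proves "`ℤ/N ⊄ (E_{/𝔽_q})⁰`" at **every** bad `q` via
`X₀(N)_{/ℤ[1/2N]}` and the Eisenstein quotient; that argument remains necessary only for bad
primes `q ≥ N - 1`.)
[cite: Mazur1977, Ch. III §5, Steps 1–3, pp. 158–160; SilvermanATAEC1994, Cor. IV.9.2(d) (PDF p. 340)] -/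
theorem Mazur1977_not_mem_goodReductionSubgroup_of_lt {N : ℕ} (hN : N.Prime)
    (hNS : N ∉ ({2, 3, 5, 7, 13} : Finset ℕ)) {P : W.toAffine.Point} (hP : addOrderOf P = N)
    (hq : q + 1 < N) (hbad : ¬ W.HasGoodReductionAtPrime q) :
    VariableChange.pointEquiv (W.baseChange ℚ_[q])
        ((W.baseChange ℚ_[q]).exists_isMinimal ℤ_[q]).choose
        (Affine.Point.map (W' := W.toAffine) (S := ℚ) (Algebra.ofId ℚ ℚ_[q]) P) ∉
      ((W.baseChange ℚ_[q]).minimal ℤ_[q]).goodReductionSubgroup ℤ_[q] ∧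
    W.HasSplitMultiplicativeReductionAtPrime q ∧
    N ∣ (W.baseChange ℚ_[q]).localTamagawaNumber ℤ_[q] ∧
    IsDedekindDomain.HeightOneSpectrum.valuation ℚ_[q] (IsDiscreteValuationRing.maximalIdeal ℤ_[q])
        ((W.baseChange ℚ_[q]).minimal ℤ_[q]).Δ =
      WithZero.exp (-((W.baseChange ℚ_[q]).localTamagawaNumber ℤ_[q] : ℤ)) := by
  have h11 := eleven_le_of_prime_of_not_mem hN hNS
  by_cases hq3 : q ≤ 3
  · exact Mazur1977_stepTwo_padic W q hN hP (by omega)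
  push Not at hq3
  have hq2' : q ≠ 2 := by omega
  have hq3' : q ≠ 3 := by omega
  have hqN : q ≠ N := by omega
  haveI : (W.baseChange ℚ_[q]).IsElliptic := inferInstanceAs (W.map (algebraMap ℚ ℚ_[q])).IsElliptic
  have hmin : (W.baseChange ℚ_[q]).minimal ℤ_[q] =
      ((W.baseChange ℚ_[q]).exists_isMinimal ℤ_[q]).choose • W.baseChange ℚ_[q] := rfl
  haveI : ((W.baseChange ℚ_[q]).minimal ℤ_[q]).IsElliptic := by
    rw [hmin]
    infer_instance
  haveI : Finite (IsLocalRing.ResidueField ℤ_[q]) :=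
    Finite.of_equiv (ZMod q) (PadicInt.residueField (p := q)).symm.toEquiv
  haveI : PerfectField (IsLocalRing.ResidueField ℤ_[q]) := PerfectField.ofFinite
  set P' : ((W.baseChange ℚ_[q]).minimal ℤ_[q]).toAffine.Point :=
    VariableChange.pointEquiv (W.baseChange ℚ_[q])
      ((W.baseChange ℚ_[q]).exists_isMinimal ℤ_[q]).choose
      (Affine.Point.map (W' := W.toAffine) (S := ℚ) (Algebra.ofId ℚ ℚ_[q]) P) with hP'
  have hP'ord : addOrderOf P' = N :=
    ((AddEquiv.addOrderOf_eq _ _).trans (addOrderOf_injective _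
      (Affine.Point.map_injective (W' := W.toAffine) (f := Algebra.ofId ℚ ℚ_[q])) P)).trans hP
  have hP'0 : P' ≠ 0 := by
    intro h0
    rw [h0, addOrderOf_zero] at hP'ord
    exact absurd hP'ord.symm (by omega)
  have hkill' : N • P' = 0 := by
    have e := addOrderOf_nsmul_eq_zero P'
    rwa [hP'ord] at e
  have hkill : (N : ℤ) • P' = 0 := by rw [natCast_zsmul]; exact hkill'
  -- multiplicative reduction at `q`
  have hmult : ((W.baseChange ℚ_[q]).minimal ℤ_[q]).HasMultiplicativeReduction ℤ_[q] := by
    rcases hasGoodReduction_or_hasMultiplicativeReduction_or_hasAdditiveReduction ℤ_[q]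
        (W := (W.baseChange ℚ_[q]).minimal ℤ_[q]) with hg | hm | ha
    · exact absurd hg hbad
    · exact hm
    · exact absurd ha (Mazur1977_stepOne_padic W q hN (by omega) hP hqN)
  haveI := hmult
  -- `P' ∉ E₀(ℚ_q)`
  have hnot : P' ∉ ((W.baseChange ℚ_[q]).minimal ℤ_[q]).goodReductionSubgroup ℤ_[q] := by
    intro hmem
    have hdvd := prime_dvd_sq_sub_one_of_mem_goodReductionSubgroup hq2' hq3' hN hqN
      ((W.baseChange ℚ_[q]).minimal ℤ_[q]) hP'0 hkill hmem
    have hq1 : 1 ≤ q := by omega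
    have hfac : q ^ 2 - 1 = (q - 1) * (q + 1) := by
      zify [hq1, Nat.one_le_pow 2 q hq1]
      ring
    rw [hfac] at hdvd
    rcases (Nat.Prime.dvd_mul hN).mp hdvd with h | h
    · have := Nat.le_of_dvd (by omega) h
      omega
    · have := Nat.le_of_dvd (by omega) h
      omega
  obtain ⟨hsplit, hdvd⟩ := hasSplitMultiplicativeReduction_of_not_mem_goodReductionSubgroup ℤ_[q]
    ((W.baseChange ℚ_[q]).minimal ℤ_[q]) hN (by omega) hkill' hnot
  haveI := hsplit
  obtain ⟨-, hv⟩ := ((W.baseChange ℚ_[q]).minimal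
    ℤ_[q]).index_goodReductionSubgroup_of_hasSplitMultiplicativeReduction_holds ℤ_[q]
  exact ⟨hnot, hsplit, hdvd, hv⟩

/-- **Split multiplicative reduction, off `E₀`, with `N ∣ c_q`, at every prime `q` with
`q + 1 + 2√q < N`** (the tree's `Mazur1977_stepTwo_padic`, whose hypothesis `2q + 1 < N` came
from the trivial count, in the strength given by the Riemann hypothesis and the node count): such
a `q` is a prime of bad reduction (`Mazur1977_not_hasGoodReductionAtPrime_of_hasse_lt`) with
`q + 1 < N`. [cite: Mazur1977, Ch. III §5, Steps 1–2, pp. 158–159] -/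
theorem Mazur1977_not_mem_goodReductionSubgroup_of_hasse_lt {N : ℕ} (hN : N.Prime)
    (hNS : N ∉ ({2, 3, 5, 7, 13} : Finset ℕ)) {P : W.toAffine.Point} (hP : addOrderOf P = N)
    (hq : (q : ℝ) + 1 + 2 * Real.sqrt q < N) :
    VariableChange.pointEquiv (W.baseChange ℚ_[q])
        ((W.baseChange ℚ_[q]).exists_isMinimal ℤ_[q]).choose
        (Affine.Point.map (W' := W.toAffine) (S := ℚ) (Algebra.ofId ℚ ℚ_[q]) P) ∉
      ((W.baseChange ℚ_[q]).minimal ℤ_[q]).goodReductionSubgroup ℤ_[q] ∧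
    W.HasSplitMultiplicativeReductionAtPrime q ∧
    N ∣ (W.baseChange ℚ_[q]).localTamagawaNumber ℤ_[q] ∧
    IsDedekindDomain.HeightOneSpectrum.valuation ℚ_[q] (IsDiscreteValuationRing.maximalIdeal ℤ_[q])
        ((W.baseChange ℚ_[q]).minimal ℤ_[q]).Δ =
      WithZero.exp (-((W.baseChange ℚ_[q]).localTamagawaNumber ℤ_[q] : ℤ)) := by
  have hq' : q + 1 < N := by
    have hs : 0 < Real.sqrt q := Real.sqrt_pos.mpr (by exact_mod_cast (Fact.out : q.Prime).pos)
    have h : (q : ℝ) + 1 < N := by linarith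
    exact_mod_cast h
  exact Mazur1977_not_mem_goodReductionSubgroup_of_lt W q hN hNS hP hq'
    (Mazur1977_not_hasGoodReductionAtPrime_of_hasse_lt W q hN hP hq)

/-- **The reduction of the putative curve at every prime `q < N - 1`**: good with
`N ∣ #Ẽ(𝔽_q)` (`Mazur1977_dvd_natCard_reduction`), or split multiplicative with the point off
`E₀(ℚ_q)` and `N ∣ c_q` (`Mazur1977_not_mem_goodReductionSubgroup_of_lt`).
[cite: Mazur1977, Ch. III §5, Steps 1–3, pp. 158–160] -/
theorem Mazur1977_reduction_of_lt {N : ℕ} (hN : N.Prime) (hNS : N ∉ ({2, 3, 5, 7, 13} : Finset ℕ))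
    {P : W.toAffine.Point} (hP : addOrderOf P = N) (hq : q + 1 < N) :
    (W.HasGoodReductionAtPrime q ∧
        N ∣ Nat.card (((W.baseChange ℚ_[q]).minimal ℤ_[q]).reduction ℤ_[q]).toAffine.Point) ∨
      (W.HasSplitMultiplicativeReductionAtPrime q ∧
        VariableChange.pointEquiv (W.baseChange ℚ_[q])
            ((W.baseChange ℚ_[q]).exists_isMinimal ℤ_[q]).choose
            (Affine.Point.map (W' := W.toAffine) (S := ℚ) (Algebra.ofId ℚ ℚ_[q]) P) ∉
          ((W.baseChange ℚ_[q]).minimal ℤ_[q]).goodReductionSubgroup ℤ_[q] ∧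
        N ∣ (W.baseChange ℚ_[q]).localTamagawaNumber ℤ_[q]) := by
  by_cases hgood : W.HasGoodReductionAtPrime q
  · exact Or.inl ⟨hgood, Mazur1977_dvd_natCard_reduction W hN hNS hP q hgood⟩
  · obtain ⟨hnot, hsplit, hdvd, -⟩ :=
      Mazur1977_not_mem_goodReductionSubgroup_of_lt W q hN hNS hP hq hgood
    exact Or.inr ⟨hsplit, hnot, hdvd⟩

end Rat

end Literature.NumberTheory.EllipticCurves

end
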